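import Summits.QuantumFields.YangMills.Theses.ComplexCouplingChannel

/-!
# `ComplexCouplingChannel.Assembly` — the assembly item of route `ComplexCouplingChannel`

Route `ComplexCouplingChannel` (sub-problem `YangMills` of summit `QuantumFields`) files, as its
assembly item `Assembly` (stmt-QuantumFields-18845), the implication chain

`TubeZeroFreeChannel → FreeEnergyWindowChannel → ComplexStrongCouplingAnchor →
HarmonicMeasureEngine → ContinuumLegGivenGap → YangMills`,

which is verbatim the (curried) type of the route's deciding theorem
`Summit.QuantumFields.YangMills.Theses.ComplexCouplingChannel.closes`.  Its content is pure
bookkeeping: fix a compact simple `G` with its Borel σ-algebra; the shared existence leg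
`ContinuumLegGivenGap` reduces the `G`-clause of `YangMills` to the volume-uniform weak-coupling
lattice gap for every faithful unitary `r`, and the engine `HarmonicMeasureEngine`, fed with the
anchor `ComplexStrongCouplingAnchor` and the two channel cruxes `TubeZeroFreeChannel`,
`FreeEnergyWindowChannel`, returns exactly that body at `(G, r)`.  The bookkeeping is inlined here
(rather than `exact closes …`) so that the file does not depend on the current shape of `closes`.
It adds no mathematics of its own.

Sources: route-internal (the deciding theorem `closes`); Jaffe–Witten 2000 for the clauses packaged
in `YangMills`; Penrose–Lebowitz 1974 for the engine's template (not used here).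
Deliberately NOT here: any of the cruxes/supports (`TubeZeroFreeChannel`, `FreeEnergyWindowChannel`,
`ComplexStrongCouplingAnchor`, `HarmonicMeasureEngine`, `ContinuumLegGivenGap`) — they stay open
items of the route.
-/

namespace Summit.QuantumFields.YangMills.Theorems

/-- **`ComplexCouplingChannel.Assembly` holds** (assembly item stmt-QuantumFields-18845): the chain
`TubeZeroFreeChannel → FreeEnergyWindowChannel → ComplexStrongCouplingAnchor →
HarmonicMeasureEngine → ContinuumLegGivenGap → YangMills`.
Proof: fix a compact simple `G`, put the Borel σ-algebra on it, apply the existence leg at `G` and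
discharge its lattice-gap hypothesis at each faithful `r` by the engine fed with the anchor and the
two channel cruxes (the bookkeeping of the route's deciding theorem `closes`, inlined). [folklore] -/
theorem complexCouplingChannel_assembly_proof :
    Summit.QuantumFields.YangMills.Theses.ComplexCouplingChannel.Assembly := by
  unfold Summit.QuantumFields.YangMills.Theses.ComplexCouplingChannel.Assembly
  intro hT hF hA hE hC G _ _ _ _ hG
  letI : MeasurableSpace G := borel G
  haveI : BorelSpace G := ⟨rfl⟩
  exact hC G hG fun r => hE hA hT hF G hG r

end Summit.QuantumFields.YangMills.Theorems
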